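import Literature.Probability.Percolation.TrapTipGuards
import Literature.Probability.Percolation.TrapPairCrossGeom
import HarnessLib

/-!
# The midpoint guard keeps the tips of all terms away from the midpoint of the side

Topic `Literature/Probability/Percolation`; family `crit-perc` / near-critical percolation on `𝕋`.
A brick of the near-critical arm-separation theorem for four arms in the ADJACENT colour
arrangement (P. Nolin, EJP 13 (2008), Thm. 11, `j = 4`, `σ = BBWW` [arXiv 0711.4948: Thm. 10];
the input `hsepAdj` of `Werner2009_lemma63_of_altSeparation_of_adjSeparation`).

The cross-frame pair step (`CrossData.exists_two_clean_routes_of_rot`, `TrapPairCrossGeom.lean`)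
asks for the MIDPOINT GUARD `PairDataB.MidGuard`: no tip of a term (from below or from above) within
`8 k_j` of the midpoint `(2M, -M)` of the side, for every scale `j < K`. As for the corner guards
(`TrapTipGuards.lean`), a closed frame of scale `R ≥ 8 k_{K-1}` about the midpoint forces it: an open
path from a site left of the frame to a tip inside the inner box of the frame would meet the frame
(`FrameData.exists_mem_K`).

* `extC₃ M = (2M, -M)` — the midpoint of the side `0`;
* `tip_avoid_mid_of_guard'` — the general statement for open paths;
* `term_tip_avoid_mid_of_guard`, `termUp_tip_avoid_mid_of_guard` — for the terms of both explorations;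
* `PairDataB.midGuard_of_guard` — **the midpoint guard from a closed frame about the midpoint**.

Everything here is proved; no named facts are introduced.

## References

* P. Nolin, Near-critical percolation in two dimensions, *Electron. J. Probab.* 13 (2008), §4.4
  (arXiv 0711.4948: proof of Thm. 10, protected points `Z±`) [Nolin2008].
-/

noncomputable section

open Set

namespace Literature.Probability.Percolation

open LatticeModels

/-- The midpoint `(2M, -M)` of the side `0` of `∂Λ_{2M}`. [folklore] -/
def extC₃ (M : ℕ) : Site 2 := ![2 * (M : ℤ), -(M : ℤ)]

/-- **A guard about the midpoint keeps tips away from it, for paths starting left of the guard.** If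
the closed sites of `χ` contain a frame of scale `R ≥ 1` about `(2M, -M)`, then the end `z ∈ trapO M`
of a `χ`-open path from a site `a` with `a₀ ≤ 2M - 2R` has `z₁ + R < -M` or `-M + R < z₁`. [cite: Nolin2008, §4.4 Thm. 11 (proof) (arXiv 0711.4948: Thm. 10)] -/
theorem tip_avoid_mid_of_guard' {M R : ℕ} (hR : 1 ≤ R) {χ : SiteConfig (Site 2)} (hmid : χᶜ ∈ triFrameAt (extC₃ M) R)
    {A : Set (Site 2)} {a z : Site 2} (ha : a 0 ≤ 2 * (M : ℤ) - 2 * R) (hz : z ∈ trapO M)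
    (hp : PathIn triGraph (A ∩ χ) a z) : z 1 + R < -(M : ℤ) ∨ -(M : ℤ) + R < z 1 := by
  obtain ⟨hz0, -, -⟩ := trapO_coord hz
  by_contra h
  push Not at h
  obtain ⟨F⟩ := nonempty_frameData hmid
  obtain ⟨v, hvA, hvK⟩ := F.exists_mem_K hR (s := z) (t := a)
    (by simp only [extC₃, Matrix.cons_val_zero, Matrix.cons_val_one, Matrix.cons_val_fin_one]; omega)
    (by simp only [extC₃, Matrix.cons_val_zero, Matrix.cons_val_one, Matrix.cons_val_fin_one]; omega) hp.symm
  exact F.K_subset hvK hvA.2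

/-- **Terms from below avoid the midpoint under the guard** (`2R + 1 ≤ M`). [cite: Nolin2008, §4.4 Thm. 11 (proof) (arXiv 0711.4948: Thm. 10)] -/
theorem term_tip_avoid_mid_of_guard {M R : ℕ} (hR : 1 ≤ R) (hRM : 2 * R + 1 ≤ M)
    {χ : SiteConfig (Site 2)} (hmid : χᶜ ∈ triFrameAt (extC₃ M) R)
    {u : ℕ} {c : Finset (Site 2)} {z : Site 2} (hu : (trapDomain M).lowestSeq χ u = some (c, z)) :
    z 1 + R < -(M : ℤ) ∨ -(M : ℤ) + R < z 1 := by
  obtain ⟨hc, hcω⟩ := JDomain.isCrossing_of_lowestSeq hu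
  obtain ⟨f, hfc, hfI⟩ := hc.exists_start
  have hf0 := (mem_trapI.1 hfI).2
  refine tip_avoid_mid_of_guard' hR hmid (A := (↑c : Set (Site 2))) (a := f) (by omega) hc.tip_mem_J ?_
  exact (hc.conn f hfc z hc.tip_mem).mono fun v hv => ⟨hv, hcω hv⟩

/-- **Terms from above avoid the midpoint under the guard** (`2R + 1 ≤ M`). [cite: Nolin2008, §4.4 Thm. 11 (proof) (arXiv 0711.4948: Thm. 10)] -/
theorem termUp_tip_avoid_mid_of_guard {M R : ℕ} (hR : 1 ≤ R) (hRM : 2 * R + 1 ≤ M)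
    {χ : SiteConfig (Site 2)} (hmid : χᶜ ∈ triFrameAt (extC₃ M) R)
    {u : ℕ} {d : Finset (Site 2)} {z : Site 2} (hu : (trapDomain M).flip.lowestSeq χ u = some (d, z)) :
    z 1 + R < -(M : ℤ) ∨ -(M : ℤ) + R < z 1 := by
  obtain ⟨hd', hdω⟩ := JDomain.isCrossing_of_lowestSeq hu
  have hd := (JDomain.flip_isCrossing_iff _).1 hd'
  obtain ⟨f, hfd, hfI⟩ := hd.exists_start
  have hf0 := (mem_trapI.1 hfI).2
  refine tip_avoid_mid_of_guard' hR hmid (A := (↑d : Set (Site 2))) (a := f) (by omega) hd.tip_mem_J ?_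
  exact (hd.conn f hfd z hd.tip_mem).mono fun v hv => ⟨hv, hdω hv⟩

/-- **The midpoint guard from a closed frame about the midpoint** of scale `R` with
`8 k_{K-1} ≤ R`, `2R + 1 ≤ M`. [cite: Nolin2008, §4.4 Thm. 11 (proof) (arXiv 0711.4948: Thm. 10)] -/
theorem PairDataB.midGuard_of_guard {M n k₀ K T T' R : ℕ} {χ : SiteConfig (Site 2)} (D : PairDataB M n k₀ K T T' χ)
    (hR : 8 * trapScale k₀ (K - 1) ≤ R) (hRM : 2 * R + 1 ≤ M) (hmid : χᶜ ∈ triFrameAt (extC₃ M) R) : D.MidGuard := by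
  have hk₀ : 1 ≤ k₀ := by have := D.hk₀; omega
  have hR1 : 1 ≤ R := le_trans (by have := one_le_trapScale hk₀ (K - 1); omega) hR
  have hsc : ∀ j < K, 8 * (trapScale k₀ j : ℤ) ≤ R := fun j hj => by
    have h := trapScale_mono k₀ (show j ≤ K - 1 by omega)
    have : (8 * trapScale k₀ j : ℕ) ≤ R := le_trans (Nat.mul_le_mul_left 8 h) hR
    exact_mod_cast this
  refine ⟨fun u c z hu j hj => ?_, fun u d z hu j hj => ?_⟩
  · have h := term_tip_avoid_mid_of_guard hR1 hRM hmid hu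
    have := hsc j hj
    omega
  · have h := termUp_tip_avoid_mid_of_guard hR1 hRM hmid hu
    have := hsc j hj
    omega

end Literature.Probability.Percolation
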